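import Summits.QuantumFields.YangMills.Theorems.FlatTubeReductionRecordProfileReweightedNumbers
import Summits.QuantumFields.YangMills.Theorems.FlatTubeReductionReferenceMassBounds
import Summits.QuantumFields.YangMills.Theorems.FlatTubeReductionReweightedProfile
import Summits.QuantumFields.YangMills.Theorems.LuscherReductionTwistedTraceScalingBTProductForm
import HarnessLib

/-!
# The reference mass of the reweighted record profile, by profile numbers

Support file for the crux `NearFlatRatioLaw` (line `ratepack_v2`, stub `stub_hODpot_A`, last fibre-side step of
`Cruxes/NearFlatRatioLaw/Lines/ratepack-v7-moments-g18.md` §14).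

`…RecordFibreFactor.record_fibre_factor_le_reference_mass` bounds every fibre factor of the `(C2)`-moments core bound by
`β^{-(a+k+j)}·Ξ·fpBOKernel β Ω′ (fpWeight β⁻¹) 1 1`, `Ω′ = recordProfile·(1+β‖x‖²)^4`.  Here that reference mass is made explicit:
`fpBOKernel = ∫ fpTriple` (`…BTProductForm.fpBOKernel_eq_integral_prod`) `≤ K₁(1,1)·V(β)·[(∫Ω′)² + ((5√2)^{3n}+(√2)^{3n})(∫Ω′)(∫Ω′(√β‖x̂‖)^{3n})]`
(`RateTube.reference_mass_on_fibreSet_le` with `Rg = univ`), and the profile numbers of `Ω′` are `≤ A·∫_{coreBox} recordProfile`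
(`RateTube.recordProfile_reweighted_moment_le_core`): `record_reference_mass_le` —
`fpBOKernel β Ω′ (fpWeight β⁻¹) 1 1 ≤ K₁(1,1)·V(β)·C_A·(∫_{coreBox} recordProfile)²`, `V(β) = 5e·4^{3n}(3n)!·fpZ β⁻¹·(π²/12)^n(3L)^{3n}3^{3n}β^{-3n/2}`.
-/

noncomputable section

open MeasureTheory Filter Topology Real Set
open scoped BigOperators
open Literature.MathematicalPhysics.QuantumFieldTheory
open Literature.MathematicalPhysics.QuantumLattice

namespace Summit.QuantumFields.YangMills.Theorems.FemtoTransferGap.RateTube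

open Summit.QuantumFields.YangMills.Theorems.FemtoTransferGap
open Summit.QuantumFields.YangMills.Theorems.FemtoTransferGap.TwoLattice
open Summit.QuantumFields.YangMills.Theorems.FemtoTransferGap.TwoLattice.ConstTube
open Summit.QuantumFields.YangMills.Theorems.FemtoTransferGap.TwoLattice.Avg
open Summit.QuantumFields.YangMills.Theorems.FemtoTransferGap.TwoLattice.Stiff
open Summit.QuantumFields.YangMills.Theorems.FemtoTransferGap.TwoLattice.GnChart

variable (L : ℕ) [NeZero L]

/-- ★★★ **THE REFERENCE MASS OF THE REWEIGHTED RECORD PROFILE** (see the module docstring). [cite: Luscher1983, §3] -/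
theorem record_reference_mass_le (hL : 2 ≤ L) :
    ∃ CA β₅ : ℝ, 0 ≤ CA ∧ ∀ β : ℝ, β₅ ≤ β →
      fpBOKernel L β (fun x => recordProfile L β x * (1 + β * ‖x‖ ^ 2) ^ 4) (fpWeight L (powScale 1 β)) 1 1 ≤
        transferKernel su2Rep ((L : ℝ) ^ 3 * β) (1 : GaugeConfig 3 1 SU2) 1 *
          ((5 * Real.exp 1 * 4 ^ (3 * Fintype.card {x : Site 3 L // ¬x = 0}) * (3 * Fintype.card {x : Site 3 L // ¬x = 0}).factorial *
            (fpZ (powScale 1 β) * (π ^ 2 / 12) ^ Fintype.card {x : Site 3 L // ¬x = 0} * (3 * (L : ℝ)) ^ (3 * Fintype.card {x : Site 3 L // ¬x = 0}) *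
              3 ^ (3 * Fintype.card {x : Site 3 L // ¬x = 0}) * ((Real.sqrt β)⁻¹) ^ (3 * Fintype.card {x : Site 3 L // ¬x = 0}))) *
          (CA * (∫ v in coreBox L β, recordProfile L β (linkEmbed L v) ∂orthoTransverse L) ^ 2)) := by
  have hle := measurable_linkEmbed L
  obtain ⟨hΩm, hΩ01, hΩabs, -⟩ := recordProfile_fields L
  obtain ⟨A, β₃, hA0, hβ₃1, hnum⟩ := recordProfile_reweighted_moment_le_core L hL
  set n : ℕ := Fintype.card {x : Site 3 L // ¬x = 0} with hn
  refine ⟨A 4 * A 4 + ((5 * Real.sqrt 2) ^ (3 * n) + Real.sqrt 2 ^ (3 * n)) * (A (4 + 3 * n) * A 4), β₃,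
    add_nonneg (mul_nonneg (hA0 4) (hA0 4)) (mul_nonneg (by positivity) (mul_nonneg (hA0 _) (hA0 4))), fun β hβ => ?_⟩
  have hβ1 : 1 ≤ β := hβ₃1.trans hβ
  have hβp : 0 < β := by linarith
  -- the reweighted profile's data
  have hΩt : ∀ v : Edge 3 L → Fin 3 → ℝ, recordProfile L β (linkEmbed L v) ≠ 0 → v ∈ capBalancedSet L ∧ ‖linkEmbed L v‖ ≤ min (1 / 40) (powScale (1 / 2) β * btLog β) :=
    fun v hv => ⟨(recordProfile_support L hv).1, (recordProfile_support L hv).2.2⟩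
  obtain ⟨hΩ'm, hΩ'0, hΩ'b, hΩ't⟩ := reweight_props (L := L) hβp.le (hΩm β) (hΩabs β) (fun x => (hΩ01 β x).1) hΩt 4
  -- step 1: the kernel is one integral; step 2: the mass bound with `Rg = univ`
  have h1 := fpBOKernel_eq_integral_prod β hΩ'm hΩ'b (measurable_fpWeight L (powScale 1 β)) (abs_fpWeight_le L (powScale 1 β)) 1 1
  have h2 := reference_mass_on_fibreSet_le (L := L) hβp hΩ'm hΩ'b hΩ'0 hΩ't (powScale 1 β) (MeasurableSet.univ : MeasurableSet (Set.univ : Set (Edge 3 L → Fin 3 → ℝ)))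
  have eU : {p : (Edge 3 L → Fin 3 → ℝ) × ((Edge 3 L → Fin 3 → ℝ) × (Site 3 L → SU2)) | p.1 ∈ (Set.univ : Set (Edge 3 L → Fin 3 → ℝ))} = Set.univ := by
    ext p; simp
  rw [eU, Measure.restrict_univ, Measure.restrict_univ, ← h1] at h2
  -- step 3: the profile numbers
  obtain ⟨h40, -⟩ := hnum β hβ 4 0 0
  obtain ⟨h43, -⟩ := hnum β hβ 4 (3 * n) 0
  set θ : ℝ := ∫ v in coreBox L β, recordProfile L β (linkEmbed L v) ∂orthoTransverse L with hθ
  have hθ0 : 0 ≤ θ := by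
    rw [hθ]; exact setIntegral_nonneg (measurableSet_coreBox L β) fun v _ => (hΩ01 β _).1
  have hM0 : ∫ v, recordProfile L β (linkEmbed L v) * (1 + β * ‖linkEmbed L v‖ ^ 2) ^ 4 ∂orthoTransverse L ≤ A 4 * θ := by
    have e : ∀ v : Edge 3 L → Fin 3 → ℝ, recordProfile L β (linkEmbed L v) * (1 + β * ‖linkEmbed L v‖ ^ 2) ^ 4 =
        recordProfile L β (linkEmbed L v) * (1 + β * ‖linkEmbed L v‖ ^ 2) ^ 4 * (Real.sqrt β * ‖linkEmbed L v‖) ^ 0 := fun v => by rw [pow_zero, mul_one]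
    rw [integral_congr_ae (ae_of_all _ e)]; simpa only [add_zero] using h40
  have hM3 : ∫ v, recordProfile L β (linkEmbed L v) * (1 + β * ‖linkEmbed L v‖ ^ 2) ^ 4 * (Real.sqrt β * ‖linkEmbed L v‖) ^ (3 * n) ∂orthoTransverse L ≤ A (4 + 3 * n) * θ := h43
  have hI0 : 0 ≤ ∫ v, recordProfile L β (linkEmbed L v) * (1 + β * ‖linkEmbed L v‖ ^ 2) ^ 4 ∂orthoTransverse L := integral_nonneg fun v => hΩ'0 _
  have hI3 : 0 ≤ ∫ v, recordProfile L β (linkEmbed L v) * (1 + β * ‖linkEmbed L v‖ ^ 2) ^ 4 * (Real.sqrt β * ‖linkEmbed L v‖) ^ (3 * n) ∂orthoTransverse L :=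
    integral_nonneg fun v => mul_nonneg (hΩ'0 _) (by positivity)
  -- the scaled moments
  have e5 : ∫ v, recordProfile L β (linkEmbed L v) * (1 + β * ‖linkEmbed L v‖ ^ 2) ^ 4 * (Real.sqrt β * (5 * (Real.sqrt 2 * ‖linkEmbed L v‖))) ^ (3 * n) ∂orthoTransverse L =
      (5 * Real.sqrt 2) ^ (3 * n) * ∫ v, recordProfile L β (linkEmbed L v) * (1 + β * ‖linkEmbed L v‖ ^ 2) ^ 4 * (Real.sqrt β * ‖linkEmbed L v‖) ^ (3 * n) ∂orthoTransverse L := by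
    rw [← integral_const_mul]
    refine integral_congr_ae (ae_of_all _ fun v => ?_)
    dsimp only
    rw [show Real.sqrt β * (5 * (Real.sqrt 2 * ‖linkEmbed L v‖)) = (5 * Real.sqrt 2) * (Real.sqrt β * ‖linkEmbed L v‖) by ring, mul_pow]; ring
  have e2 : ∫ v, recordProfile L β (linkEmbed L v) * (1 + β * ‖linkEmbed L v‖ ^ 2) ^ 4 * (Real.sqrt β * (Real.sqrt 2 * ‖linkEmbed L v‖)) ^ (3 * n) ∂orthoTransverse L =
      Real.sqrt 2 ^ (3 * n) * ∫ v, recordProfile L β (linkEmbed L v) * (1 + β * ‖linkEmbed L v‖ ^ 2) ^ 4 * (Real.sqrt β * ‖linkEmbed L v‖) ^ (3 * n) ∂orthoTransverse L := by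
    rw [← integral_const_mul]
    refine integral_congr_ae (ae_of_all _ fun v => ?_)
    dsimp only
    rw [show Real.sqrt β * (Real.sqrt 2 * ‖linkEmbed L v‖) = Real.sqrt 2 * (Real.sqrt β * ‖linkEmbed L v‖) by ring, mul_pow]; ring
  -- combine
  have hK1 : 0 ≤ transferKernel su2Rep ((L : ℝ) ^ 3 * β) (1 : GaugeConfig 3 1 SU2) 1 := (transferKernel_pos su2Rep _ _ _).le
  have hV0 : 0 ≤ 5 * Real.exp 1 * 4 ^ (3 * n) * (3 * n).factorial *
      (fpZ (powScale 1 β) * (π ^ 2 / 12) ^ n * (3 * (L : ℝ)) ^ (3 * n) * 3 ^ (3 * n) * ((Real.sqrt β)⁻¹) ^ (3 * n)) := by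
    have := (fpZ_pos (powScale_pos 1 β)).le; positivity
  have hbr : (∫ v, recordProfile L β (linkEmbed L v) * (1 + β * ‖linkEmbed L v‖ ^ 2) ^ 4 ∂orthoTransverse L) *
        (∫ v, recordProfile L β (linkEmbed L v) * (1 + β * ‖linkEmbed L v‖ ^ 2) ^ 4 ∂orthoTransverse L) +
      (∫ v, recordProfile L β (linkEmbed L v) * (1 + β * ‖linkEmbed L v‖ ^ 2) ^ 4 * (Real.sqrt β * (5 * (Real.sqrt 2 * ‖linkEmbed L v‖))) ^ (3 * n) ∂orthoTransverse L) *
        (∫ v, recordProfile L β (linkEmbed L v) * (1 + β * ‖linkEmbed L v‖ ^ 2) ^ 4 ∂orthoTransverse L) +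
      (∫ v, recordProfile L β (linkEmbed L v) * (1 + β * ‖linkEmbed L v‖ ^ 2) ^ 4 ∂orthoTransverse L) *
        ∫ v, recordProfile L β (linkEmbed L v) * (1 + β * ‖linkEmbed L v‖ ^ 2) ^ 4 * (Real.sqrt β * (Real.sqrt 2 * ‖linkEmbed L v‖)) ^ (3 * n) ∂orthoTransverse L ≤
      (A 4 * A 4 + ((5 * Real.sqrt 2) ^ (3 * n) + Real.sqrt 2 ^ (3 * n)) * (A (4 + 3 * n) * A 4)) * θ ^ 2 := by
    rw [e5, e2]
    have p1 := mul_le_mul hM0 hM0 hI0 (mul_nonneg (hA0 4) hθ0)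
    have p2 := mul_le_mul hM3 hM0 hI0 (mul_nonneg (hA0 _) hθ0)
    have h52 : 0 ≤ (5 * Real.sqrt 2) ^ (3 * n) := by positivity
    have h2n : 0 ≤ Real.sqrt 2 ^ (3 * n) := by positivity
    have p2a := mul_le_mul_of_nonneg_left p2 h52
    have p2b := mul_le_mul_of_nonneg_left p2 h2n
    nlinarith [p1, p2a, p2b, mul_nonneg hI3 hI0]
  calc fpBOKernel L β (fun x => recordProfile L β x * (1 + β * ‖x‖ ^ 2) ^ 4) (fpWeight L (powScale 1 β)) 1 1 ≤ _ := h2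
    _ ≤ _ := by
      rw [← hn]
      exact mul_le_mul_of_nonneg_left (mul_le_mul_of_nonneg_left hbr hV0) hK1

end Summit.QuantumFields.YangMills.Theorems.FemtoTransferGap.RateTube

end
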